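import Literature.AlgebraicGeometry.Limits.LimitSectionsDescent
import Literature.AlgebraicGeometry.Modules.IsoOfFramesMatrix
import Literature.AlgebraicGeometry.Modules.PullbackFrame
import Literature.AlgebraicGeometry.Modules.DetClassOfIso
import HarnessLib

/-!
# Limits of schemes: isomorphisms of finite locally free modules descend to a stage (Stacks 01ZR (2)–(3))

Topic: `Literature/AlgebraicGeometry/Limits`. For the limit `c.pt = lim_i D i` of a cofiltered diagram of
quasi-compact quasi-separated schemes with affine transition maps (the setting of ★ `FiniteLocallyFreeDescent`,
Stacks 0B8W (1)) and finite locally free `ℰ`, `ℱ` on ONE stage `D i` with `φ : π_i^* ℰ ≅ π_i^* ℱ`, there is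
`h : k ⟶ i` with `(D h)^* ℰ ≅ (D h)^* ℱ` (`exists_stage_iso_of_pullback_iso`) — what is needed to descend a
line bundle TOGETHER WITH isomorphism data (a rigidification, a comparison) along `Spec B = lim Spec K[t]`.
Proof: common frames on a finite cover of `D i` (`exists_common_frames`); on the limit the matrices of `φ` in the
pulled-back frames (★ `Modules/PullbackFrame`) are transition matrices between the frames `π_i^* f_a` and
`π_i^* e_a ≫ φ` (★ `Modules.transition_trans_mapIso`), so `N M = 1`, `M N = 1` and `T(f_a,f_b) M_b = M_a T(e_a,e_b)`
are cocycle identities (★ `Modules/FrameTransition`); entries descend (★ `Limits/LimitSectionsDescent`, Stacks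
01Z0), identities hold at a deeper stage, and the matrices glue there (★ `Modules.nonempty_iso_of_framesMatrix`).
Everything is proved; theorems only; no named facts.

## References
* The Stacks Project, Lemma 32.10.2 (2)–(3) (Tag 01ZR); Lemma 32.10.3 (1) (Tag 0B8W); Lemma 32.4.7 (Tag 01Z0). [StacksProject]
* A. Grothendieck, J. Dieudonné, EGA IV₃ (1966), Thm. 8.5.2 (i)–(ii), Cor. 8.5.5. [EGAIV3]
* U. Görtz, T. Wedhorn, *Algebraic Geometry I*, 2nd ed. (2020), Thm. 10.60 and Exercise 10.33. [GortzWedhorn2020]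
* R. Hartshorne, *Algebraic Geometry* (1977), II Ex. 5.18. [Hartshorne1977]
-/

universe u

open CategoryTheory CategoryTheory.Limits AlgebraicGeometry TopologicalSpace Opposite

/-! ## §1  Common frames of two finite locally free modules on a quasi-compact scheme -/

namespace Literature.AlgebraicGeometry.Limits

open Literature.AlgebraicGeometry.Motives Literature.AlgebraicGeometry.Modules

set_option backward.isDefEq.respectTransparency false

namespace FiniteLocallyFreeIsoDescent

/-- **Two finite locally free modules on a quasi-compact scheme are trivialised on ONE finite cover by
affine (hence quasi-compact) opens** (frames exist locally for each; shrink to an affine open inside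
both neighbourhoods — Mathlib `Scheme.isBasis_affineOpens`; finitely many by compactness).
[cite: StacksProject, Tag 01C6 (Modules Def. 17.14.1 (2))] -/
theorem exists_common_frames {Y : Scheme.{u}} [CompactSpace Y] {ℰ ℱ : Y.Modules}
    (hℰ : IsFiniteLocallyFree ℰ) (hℱ : IsFiniteLocallyFree ℱ) :
    ∃ (ι : Type u) (_ : Fintype ι) (V : ι → Y.Opens) (J J' : ι → Type u)
      (_ : ∀ a, Fintype (J a)) (_ : ∀ a, Fintype (J' a))
      (_ : ∀ a, SheafOfModules.free (J a) ≅ ℰ.over (V a))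
      (_ : ∀ a, SheafOfModules.free (J' a) ≅ ℱ.over (V a)),
      (∀ a, IsCompact (V a : Set Y)) ∧ (⨆ a, V a) = ⊤ := by
  classical
  have hx : ∀ x : Y, ∃ (V : Y.Opens) (J J' : Type u), IsAffineOpen V ∧ x ∈ V ∧ Finite J ∧ Finite J' ∧
      Nonempty (SheafOfModules.free J ≅ ℰ.over V) ∧ Nonempty (SheafOfModules.free J' ≅ ℱ.over V) := by
    intro x
    obtain ⟨U, hxU, J, hJ, ⟨e⟩⟩ := hℰ x
    obtain ⟨U', hxU', J', hJ', ⟨e'⟩⟩ := hℱ x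
    obtain ⟨_, ⟨V, hV, rfl⟩, hxV, hVU⟩ :=
      Y.isBasis_affineOpens.exists_subset_of_mem_open
        (show x ∈ ((U ⊓ U' : Y.Opens) : Set Y) from ⟨hxU, hxU'⟩) (U ⊓ U').2
    have hVU' : V ≤ U ⊓ U' := SetLike.coe_subset_coe.mp hVU
    exact ⟨V, J, J', hV, hxV, hJ, hJ',
      ⟨SheafOfModules.restrictTrivialisation (R := Y.ringCatSheaf) (homOfLE (hVU'.trans inf_le_left)) e⟩,
      ⟨SheafOfModules.restrictTrivialisation (R := Y.ringCatSheaf) (homOfLE (hVU'.trans inf_le_right)) e'⟩⟩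
  choose V J J' hV hxV hJ hJ' he he' using hx
  obtain ⟨t, ht⟩ := CompactSpace.elim_nhds_subcover (fun x => (V x : Set Y))
    (fun x => (V x).2.mem_nhds (hxV x))
  refine ⟨↥t, inferInstance, fun x => V x, fun x => J x, fun x => J' x,
    fun x => @Fintype.ofFinite _ (hJ x), fun x => @Fintype.ofFinite _ (hJ' x),
    fun x => (he x).some, fun x => (he' x).some, fun x => (hV x).isCompact, ?_⟩
  rw [eq_top_iff]
  rintro y -
  obtain ⟨x, hxt, hy⟩ := Set.mem_iUnion₂.mp (ht.ge (Set.mem_univ y))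
  exact Opens.mem_iSup.mpr ⟨⟨x, hxt⟩, hy⟩

/-! ## §2  Plumbing: matrices of sections under `appLE` and restriction (as in ★ `FiniteLocallyFreeDescent`) -/

section Plumbing

/-- Changing the name of the morphism in `Scheme.Hom.appLE`. [folklore] -/
private lemma appLE_congr_hom' {X Y : Scheme.{u}} {f g : X ⟶ Y} (h : f = g) (U : Y.Opens)
    (V : X.Opens) (e : V ≤ f ⁻¹ᵁ U) : f.appLE U V e = g.appLE U V (h ▸ e) := by
  subst h; rfl

/-- `appLE` after restricting a matrix is one `appLE`. [folklore] -/
private lemma map_secRes_map_appLE' {X Y : Scheme.{u}} (f : X ⟶ Y) {W W' : Y.Opens} {O : X.Opens}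
    (h : W' ≤ W) (e' : O ≤ f ⁻¹ᵁ W') {m n : Type*} (M : Matrix m n Γ(Y, W)) :
    (M.map (Y.presheaf.map (homOfLE h).op).hom).map (f.appLE W' O e').hom =
      M.map (f.appLE W O (e'.trans ((Opens.map f.base).map (homOfLE h)).le)).hom := by
  rw [Matrix.map_map]
  congr 1
  funext s
  change (Y.presheaf.map (homOfLE h).op ≫ f.appLE W' O e') s = _
  rw [Scheme.Hom.map_appLE]

/-- Restricting a matrix after `appLE` is one `appLE`. [folklore] -/
private lemma map_appLE_map_secRes' {X Y : Scheme.{u}} (f : X ⟶ Y) {W : Y.Opens} {O O' : X.Opens}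
    (h' : O' ≤ O) (e : O ≤ f ⁻¹ᵁ W) {m n : Type*} (M : Matrix m n Γ(Y, W)) :
    (M.map (f.appLE W O e).hom).map (X.presheaf.map (homOfLE h').op).hom =
      M.map (f.appLE W O' (h'.trans e)).hom := by
  rw [Matrix.map_map]
  congr 1
  funext s
  change (f.appLE W O e ≫ X.presheaf.map (homOfLE h').op) s = _
  rw [Scheme.Hom.appLE_map]

/-- Two successive `appLE`s of a matrix are one `appLE` of the composite. [folklore] -/
private lemma map_appLE_map_appLE' {X Y Z : Scheme.{u}} (f : X ⟶ Y) (g : Y ⟶ Z) {U : Z.Opens}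
    {V : Y.Opens} {W : X.Opens} (e₁ : V ≤ g ⁻¹ᵁ U) (e₂ : W ≤ f ⁻¹ᵁ V) {m n : Type*}
    (M : Matrix m n Γ(Z, U)) :
    (M.map (g.appLE U V e₁).hom).map (f.appLE V W e₂).hom =
      M.map ((f ≫ g).appLE U W (e₂.trans ((Opens.map f.base).map (homOfLE e₁)).le)).hom := by
  rw [Matrix.map_map]
  congr 1
  funext s
  change (g.appLE U V e₁ ≫ f.appLE V W e₂) s = _
  rw [Scheme.Hom.appLE_comp_appLE]

/-- From an `app`-equality to the `appLE`-equality over any smaller open. [folklore] -/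
private lemma appLE_eq_of_app_eq {X Y : Scheme.{u}} (f : X ⟶ Y) {O : Y.Opens} {O' : X.Opens}
    (e : O' ≤ f ⁻¹ᵁ O) {s s' : Γ(Y, O)} (h : f.app O s = f.app O s') :
    f.appLE O O' e s = f.appLE O O' e s' := by
  change (f.app O ≫ X.presheaf.map (homOfLE e).op) s = (f.app O ≫ X.presheaf.map (homOfLE e).op) s'
  rw [CategoryTheory.comp_apply, CategoryTheory.comp_apply, h]

/-- From an `appLE`-equality over an open EQUAL to the preimage to an `app`-equality. [folklore] -/
private lemma app_eq_app_of_appLE {X Y : Scheme.{u}} (f : X ⟶ Y) {W : Y.Opens} {W' : X.Opens}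
    (h : f ⁻¹ᵁ W = W') (e : W' ≤ f ⁻¹ᵁ W) {s s' : Γ(Y, W)}
    (hs : f.appLE W W' e s = f.appLE W W' e s') : f.app W s = f.app W s' := by
  subst h
  rwa [Scheme.Hom.appLE_eq_app] at hs

/-- A matrix identity transported along `appLE` entrywise. [folklore] -/
private lemma map_appLE_eq_of_forall_app_eq {X Y : Scheme.{u}} (f : X ⟶ Y) {O : Y.Opens} {O' : X.Opens}
    (e : O' ≤ f ⁻¹ᵁ O) {m n : Type*} {A B : Matrix m n Γ(Y, O)}
    (h : ∀ p q, f.app O (A p q) = f.app O (B p q)) :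
    A.map (f.appLE O O' e).hom = B.map (f.appLE O O' e).hom := by
  ext p q
  rw [Matrix.map_apply, Matrix.map_apply]
  exact appLE_eq_of_app_eq f e (h p q)

end Plumbing

/-! ## §3  Isomorphisms of finite locally free modules descend to a stage -/

section Descent

variable {I : Type u} [Category.{u} I] [IsCofiltered I] (D : I ⥤ Scheme.{u})
  (c : Cone D) (hc : IsLimit c) [∀ {i j : I} (f : i ⟶ j), IsAffineHom (D.map f)]
  [∀ i, CompactSpace (D.obj i)] [∀ i, QuasiSeparatedSpace (D.obj i)]

include hc in
set_option maxHeartbeats 400000 in -- measured 2026-08-29: fails at the default 200000 (whnf of the assembled term), passes at 400000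
/-- **Isomorphisms of finite locally free modules on a limit of schemes come from a stage** (The Stacks
Project, Lemma 32.10.2 (2)–(3), the isomorphism case): if `ℰ`, `ℱ` are finite locally free
modules on a stage `D i` of a cofiltered limit `c.pt = lim D` of quasi-compact quasi-separated schemes
with affine transition maps and `π_i^* ℰ ≅ π_i^* ℱ`, then `(D h)^* ℰ ≅ (D h)^* ℱ` for some
`h : k ⟶ i`. [cite: StacksProject, Tag 01ZR (Lemma 32.10.2 (2)–(3))] [cite: GortzWedhorn2020, Thm. 10.60 (and Exercise 10.33)] -/
theorem exists_stage_iso_of_pullback_iso {i : I} {ℰ ℱ : (D.obj i).Modules}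
    (hℰ : IsFiniteLocallyFree ℰ) (hℱ : IsFiniteLocallyFree ℱ)
    (φ : (Scheme.Modules.pullback (c.π.app i)).obj ℰ ≅ (Scheme.Modules.pullback (c.π.app i)).obj ℱ) :
    ∃ (k : I) (h : k ⟶ i),
      Nonempty ((Scheme.Modules.pullback (D.map h)).obj ℰ ≅ (Scheme.Modules.pullback (D.map h)).obj ℱ) := by
  classical
  obtain ⟨ι, _, V, J, J', _, _, eE, eF, hVc, hVtop⟩ := exists_common_frames hℰ hℱ
  let U : ι → c.pt.Opens := fun a => c.π.app i ⁻¹ᵁ V a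
  have hUV : ∀ a, c.π.app i ⁻¹ᵁ V a = U a := fun a => rfl
  let fE : ∀ a, SheafOfModules.free (J a) ≅ ((Scheme.Modules.pullback (c.π.app i)).obj ℰ).over (U a) :=
    fun a => pullbackFrame (c.π.app i) (eE a)
  let fF : ∀ a, SheafOfModules.free (J' a) ≅ ((Scheme.Modules.pullback (c.π.app i)).obj ℱ).over (U a) :=
    fun a => pullbackFrame (c.π.app i) (eF a)
  let eφ : ∀ a, SheafOfModules.free (J a) ≅ ((Scheme.Modules.pullback (c.π.app i)).obj ℱ).over (U a) :=
    fun a => fE a ≪≫ (SheafOfModules.overFunctor _ (U a)).mapIso φ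
  let M : ∀ a, Matrix (J' a) (J a) Γ(c.pt, U a) := fun a => transition (fF a) (eφ a) (𝟙 _) (𝟙 _)
  let N : ∀ a, Matrix (J a) (J' a) Γ(c.pt, U a) := fun a => transition (eφ a) (fF a) (𝟙 _) (𝟙 _)
  have hNM : ∀ a, N a * M a = 1 := fun a => by
    simp only [M, N]; rw [transition_mul, transition_self]
  have hMN : ∀ a, M a * N a = 1 := fun a => by
    simp only [M, N]; rw [transition_mul, transition_self]
  obtain ⟨j, f, t, ht⟩ := exists_appLE_π_eq_of_finite D c hc
    (α := Σ a, (J' a × J a) ⊕ (J a × J' a)) (fun x => V x.1) (fun x => hVc x.1) (fun x => U x.1)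
    (fun x => hUV x.1) (fun x => Sum.elim (fun p => M x.1 p.1 p.2) (fun p => N x.1 p.1 p.2) x.2)
  have hle : ∀ a, U a ≤ c.π.app j ⁻¹ᵁ (D.map f ⁻¹ᵁ V a) := fun a => by
    change (c.π.app i ⁻¹ᵁ V a : c.pt.Opens) ≤ c.π.app j ⁻¹ᵁ (D.map f ⁻¹ᵁ V a)
    rw [← Scheme.Hom.comp_preimage, c.w]
  have hUV' : ∀ a, c.π.app j ⁻¹ᵁ (D.map f ⁻¹ᵁ V a) = U a := fun a => by
    change (c.π.app j ⁻¹ᵁ (D.map f ⁻¹ᵁ V a) : c.pt.Opens) = c.π.app i ⁻¹ᵁ V a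
    rw [← Scheme.Hom.comp_preimage, c.w]
  let Mj : ∀ a, Matrix (J' a) (J a) Γ(D.obj j, D.map f ⁻¹ᵁ V a) :=
    fun a => Matrix.of fun p q => t ⟨a, Sum.inl (p, q)⟩
  let Nj : ∀ a, Matrix (J a) (J' a) Γ(D.obj j, D.map f ⁻¹ᵁ V a) :=
    fun a => Matrix.of fun p q => t ⟨a, Sum.inr (p, q)⟩
  have hMj : ∀ a, (Mj a).map ((c.π.app j).appLE (D.map f ⁻¹ᵁ V a) (U a) (hle a)).hom = M a := by
    intro a; ext p q; exact ht ⟨a, Sum.inl (p, q)⟩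
  have hNj : ∀ a, (Nj a).map ((c.π.app j).appLE (D.map f ⁻¹ᵁ V a) (U a) (hle a)).hom = N a := by
    intro a; ext p q; exact ht ⟨a, Sum.inr (p, q)⟩
  have hV'c : ∀ a, IsCompact ((D.map f ⁻¹ᵁ V a : (D.obj j).Opens) : Set (D.obj j)) :=
    fun a => (D.map f).isCompact_preimage (hVc a)
  have h12 : ∀ x : Σ a, (J a × J a) ⊕ (J' a × J' a),
      (c.π.app j).app (D.map f ⁻¹ᵁ V x.1)
          (Sum.elim (fun p => (Nj x.1 * Mj x.1) p.1 p.2) (fun p => (Mj x.1 * Nj x.1) p.1 p.2) x.2) =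
        (c.π.app j).app (D.map f ⁻¹ᵁ V x.1)
          (Sum.elim (fun p => (1 : Matrix (J x.1) (J x.1) _) p.1 p.2)
            (fun p => (1 : Matrix (J' x.1) (J' x.1) _) p.1 p.2) x.2) := by
    rintro ⟨a, (⟨p, q⟩ | ⟨p, q⟩)⟩
    · refine app_eq_app_of_appLE (c.π.app j) (hUV' a) (hle a) ?_
      have h := congrFun (congrFun (show (Nj a * Mj a).map ((c.π.app j).appLE (D.map f ⁻¹ᵁ V a) (U a)
          (hle a)).hom = (1 : Matrix (J a) (J a) _).map ((c.π.app j).appLE (D.map f ⁻¹ᵁ V a) (U a)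
          (hle a)).hom by
        rw [Matrix.map_mul, hMj a, hNj a, hNM a, Matrix.map_one _ (map_zero _) (map_one _)]) p) q
      simpa only [Matrix.map_apply, Sum.elim_inl] using h
    · refine app_eq_app_of_appLE (c.π.app j) (hUV' a) (hle a) ?_
      have h := congrFun (congrFun (show (Mj a * Nj a).map ((c.π.app j).appLE (D.map f ⁻¹ᵁ V a) (U a)
          (hle a)).hom = (1 : Matrix (J' a) (J' a) _).map ((c.π.app j).appLE (D.map f ⁻¹ᵁ V a) (U a)
          (hle a)).hom by
        rw [Matrix.map_mul, hMj a, hNj a, hMN a, Matrix.map_one _ (map_zero _) (map_one _)]) p) q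
      simpa only [Matrix.map_apply, Sum.elim_inr] using h
  obtain ⟨k₁, g₁, hk₁⟩ := exists_app_map_eq_map_of_finite D c hc (i := j)
    (α := Σ a, (J a × J a) ⊕ (J' a × J' a)) (fun x => D.map f ⁻¹ᵁ V x.1) (fun x => hV'c x.1)
    (fun x => Sum.elim (fun p => (Nj x.1 * Mj x.1) p.1 p.2) (fun p => (Mj x.1 * Nj x.1) p.1 p.2) x.2)
    (fun x => Sum.elim (fun p => (1 : Matrix (J x.1) (J x.1) _) p.1 p.2)
      (fun p => (1 : Matrix (J' x.1) (J' x.1) _) p.1 p.2) x.2) h12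
  let TE : ∀ a b, Matrix (J a) (J b) Γ(D.obj i, V a ⊓ V b) :=
    fun a b => transition (eE a) (eE b) (homOfLE inf_le_left) (homOfLE inf_le_right)
  let TF : ∀ a b, Matrix (J' a) (J' b) Γ(D.obj i, V a ⊓ V b) :=
    fun a b => transition (eF a) (eF b) (homOfLE inf_le_left) (homOfLE inf_le_right)
  have hO : ∀ a b, (D.map f ⁻¹ᵁ V a ⊓ D.map f ⁻¹ᵁ V b : (D.obj j).Opens) ≤ D.map f ⁻¹ᵁ (V a ⊓ V b) :=
    fun a b => (Scheme.Hom.preimage_inf (D.map f)).symm.le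
  let sL : ∀ a b, Matrix (J' a) (J b) Γ(D.obj j, D.map f ⁻¹ᵁ V a ⊓ D.map f ⁻¹ᵁ V b) := fun a b =>
    (TF a b).map ((D.map f).appLE (V a ⊓ V b) _ (hO a b)).hom *
      (Mj b).map ((D.obj j).presheaf.map (homOfLE (inf_le_right :
        D.map f ⁻¹ᵁ V a ⊓ D.map f ⁻¹ᵁ V b ≤ D.map f ⁻¹ᵁ V b)).op).hom
  let sR : ∀ a b, Matrix (J' a) (J b) Γ(D.obj j, D.map f ⁻¹ᵁ V a ⊓ D.map f ⁻¹ᵁ V b) := fun a b =>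
    (Mj a).map ((D.obj j).presheaf.map (homOfLE (inf_le_left :
        D.map f ⁻¹ᵁ V a ⊓ D.map f ⁻¹ᵁ V b ≤ D.map f ⁻¹ᵁ V a)).op).hom *
      (TE a b).map ((D.map f).appLE (V a ⊓ V b) _ (hO a b)).hom
  have hO2c : ∀ a b, IsCompact ((D.map f ⁻¹ᵁ V a ⊓ D.map f ⁻¹ᵁ V b : (D.obj j).Opens) : Set (D.obj j)) :=
    fun a b => (hV'c a).inter_of_isOpen (hV'c b) (D.map f ⁻¹ᵁ V a).2 (D.map f ⁻¹ᵁ V b).2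
  have hUU : ∀ a b, c.π.app j ⁻¹ᵁ (D.map f ⁻¹ᵁ V a ⊓ D.map f ⁻¹ᵁ V b) = U a ⊓ U b := fun a b => by
    rw [Scheme.Hom.preimage_inf, hUV', hUV']
  have hle2 : ∀ a b, U a ⊓ U b ≤ c.π.app j ⁻¹ᵁ (D.map f ⁻¹ᵁ V a ⊓ D.map f ⁻¹ᵁ V b) :=
    fun a b => (hUU a b).symm.le
  have kF : ∀ a b, ((TF a b).map ((D.map f).appLE (V a ⊓ V b) _ (hO a b)).hom).map
      ((c.π.app j).appLE _ (U a ⊓ U b) (hle2 a b)).hom =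
      transition (fF a) (fF b) (Opens.infLELeft (U a) (U b)) (Opens.infLERight (U a) (U b)) := by
    intro a b
    simp only [fF, TF]
    rw [map_appLE_map_appLE', appLE_congr_hom' (c.w f),
      transition_pullbackFrame (c.π.app i) (eF a) (eF b)
        (le_of_eq (Scheme.Hom.preimage_inf (c.π.app i)).symm)]
    rfl
  have kE : ∀ a b, ((TE a b).map ((D.map f).appLE (V a ⊓ V b) _ (hO a b)).hom).map
      ((c.π.app j).appLE _ (U a ⊓ U b) (hle2 a b)).hom =
      transition (eφ a) (eφ b) (Opens.infLELeft (U a) (U b)) (Opens.infLERight (U a) (U b)) := by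
    intro a b
    simp only [eφ, fE, TE]
    rw [map_appLE_map_appLE', appLE_congr_hom' (c.w f),
      transition_trans_mapIso φ (pullbackFrame (c.π.app i) (eE a)) (pullbackFrame (c.π.app i) (eE b)),
      transition_pullbackFrame (c.π.app i) (eE a) (eE b)
        (le_of_eq (Scheme.Hom.preimage_inf (c.π.app i)).symm)]
    rfl
  have kMb : ∀ a b, ((Mj b).map ((D.obj j).presheaf.map (homOfLE (inf_le_right :
        D.map f ⁻¹ᵁ V a ⊓ D.map f ⁻¹ᵁ V b ≤ D.map f ⁻¹ᵁ V b)).op).hom).map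
      ((c.π.app j).appLE _ (U a ⊓ U b) (hle2 a b)).hom =
      transition (fF b) (eφ b) (Opens.infLERight (U a) (U b)) (Opens.infLERight (U a) (U b)) := by
    intro a b
    rw [map_secRes_map_appLE', ← map_appLE_map_secRes' (c.π.app j) inf_le_right (hle b), hMj]
    simp only [M]
    rw [Subsingleton.elim (Opens.infLERight (U a) (U b))
      (homOfLE (inf_le_right : U a ⊓ U b ≤ U b) ≫ 𝟙 (U b))]
    exact transition_map (fF b) (eφ b) (𝟙 (U b)) (𝟙 (U b)) (homOfLE (inf_le_right : U a ⊓ U b ≤ U b))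
  have kMa : ∀ a b, ((Mj a).map ((D.obj j).presheaf.map (homOfLE (inf_le_left :
        D.map f ⁻¹ᵁ V a ⊓ D.map f ⁻¹ᵁ V b ≤ D.map f ⁻¹ᵁ V a)).op).hom).map
      ((c.π.app j).appLE _ (U a ⊓ U b) (hle2 a b)).hom =
      transition (fF a) (eφ a) (Opens.infLELeft (U a) (U b)) (Opens.infLELeft (U a) (U b)) := by
    intro a b
    rw [map_secRes_map_appLE', ← map_appLE_map_secRes' (c.π.app j) inf_le_left (hle a), hMj]
    simp only [M]
    rw [Subsingleton.elim (Opens.infLELeft (U a) (U b))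
      (homOfLE (inf_le_left : U a ⊓ U b ≤ U a) ≫ 𝟙 (U a))]
    exact transition_map (fF a) (eφ a) (𝟙 (U a)) (𝟙 (U a)) (homOfLE (inf_le_left : U a ⊓ U b ≤ U a))
  have h3 : ∀ x : Σ p : ι × ι, J' p.1 × J p.2,
      (c.π.app j).app (D.map f ⁻¹ᵁ V x.1.1 ⊓ D.map f ⁻¹ᵁ V x.1.2) (sL x.1.1 x.1.2 x.2.1 x.2.2) =
        (c.π.app j).app (D.map f ⁻¹ᵁ V x.1.1 ⊓ D.map f ⁻¹ᵁ V x.1.2) (sR x.1.1 x.1.2 x.2.1 x.2.2) := by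
    rintro ⟨⟨a, b⟩, ⟨p, q⟩⟩
    refine app_eq_app_of_appLE (c.π.app j) (hUU a b) (hle2 a b) ?_
    have h : (sL a b).map ((c.π.app j).appLE _ (U a ⊓ U b) (hle2 a b)).hom =
        (sR a b).map ((c.π.app j).appLE _ (U a ⊓ U b) (hle2 a b)).hom := by
      simp only [sL, sR]
      rw [Matrix.map_mul, Matrix.map_mul, kF, kE, kMb, kMa, transition_mul, transition_mul]
    have h' := congrFun (congrFun h p) q
    simpa only [Matrix.map_apply] using h'
  obtain ⟨k₂, g₂, hk₂⟩ := exists_app_map_eq_map_of_finite D c hc (i := j)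
    (α := Σ p : ι × ι, J' p.1 × J p.2) (fun x => D.map f ⁻¹ᵁ V x.1.1 ⊓ D.map f ⁻¹ᵁ V x.1.2)
    (fun x => hO2c x.1.1 x.1.2) (fun x => sL x.1.1 x.1.2 x.2.1 x.2.2) (fun x => sR x.1.1 x.1.2 x.2.1 x.2.2) h3
  obtain ⟨k, m₁, m₂, hm⟩ := IsCofiltered.cospan g₁ g₂
  set g : k ⟶ j := m₁ ≫ g₁ with hg
  have hg' : g = m₂ ≫ g₂ := hm
  have pers : ∀ {j' : I} (g' : j' ⟶ j) (m : k ⟶ j') (hgm : g = m ≫ g') {O : (D.obj j).Opens}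
      {s s' : Γ(D.obj j, O)} (h : (D.map g').app O s = (D.map g').app O s'),
      (D.map g).app O s = (D.map g).app O s' := by
    intro j' g' m hgm O s s' h
    rw [hgm, Scheme.Hom.congr_app (D.map_comp m g') O, Scheme.Hom.comp_app]
    change (D.obj k).presheaf.map _ ((D.map m).app _ ((D.map g').app O s)) =
      (D.obj k).presheaf.map _ ((D.map m).app _ ((D.map g').app O s'))
    rw [h]
  refine ⟨k, g ≫ f, ?_⟩
  let W : ι → (D.obj k).Opens := fun a => D.map (g ≫ f) ⁻¹ᵁ V a
  have hWle : ∀ a, W a ≤ D.map g ⁻¹ᵁ (D.map f ⁻¹ᵁ V a) := fun a => by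
    change (D.map (g ≫ f) ⁻¹ᵁ V a : (D.obj k).Opens) ≤ _
    rw [D.map_comp, Scheme.Hom.comp_preimage]
  have hWtop : iSup W = ⊤ := by
    change (⨆ a, D.map (g ≫ f) ⁻¹ᵁ V a) = ⊤
    rw [← Scheme.Hom.preimage_iSup, hVtop]
    rfl
  let eEk : ∀ a, SheafOfModules.free (J a) ≅ ((Scheme.Modules.pullback (D.map (g ≫ f))).obj ℰ).over (W a) :=
    fun a => pullbackFrame (D.map (g ≫ f)) (eE a)
  let eFk : ∀ a, SheafOfModules.free (J' a) ≅ ((Scheme.Modules.pullback (D.map (g ≫ f))).obj ℱ).over (W a) :=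
    fun a => pullbackFrame (D.map (g ≫ f)) (eF a)
  let G : ∀ a, Matrix (J' a) (J a) Γ(D.obj k, W a) :=
    fun a => (Mj a).map ((D.map g).appLE (D.map f ⁻¹ᵁ V a) (W a) (hWle a)).hom
  let G' : ∀ a, Matrix (J a) (J' a) Γ(D.obj k, W a) :=
    fun a => (Nj a).map ((D.map g).appLE (D.map f ⁻¹ᵁ V a) (W a) (hWle a)).hom
  have hG1 : ∀ a, G' a * G a = 1 := fun a => by
    simp only [G, G']
    rw [← Matrix.map_mul, map_appLE_eq_of_forall_app_eq (D.map g) (hWle a) (A := Nj a * Mj a)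
      (B := (1 : Matrix (J a) (J a) _)) (fun p q => pers g₁ m₁ hg (hk₁ ⟨a, Sum.inl (p, q)⟩)),
      Matrix.map_one _ (map_zero _) (map_one _)]
  have hG2 : ∀ a, G a * G' a = 1 := fun a => by
    simp only [G, G']
    rw [← Matrix.map_mul, map_appLE_eq_of_forall_app_eq (D.map g) (hWle a) (A := Mj a * Nj a)
      (B := (1 : Matrix (J' a) (J' a) _)) (fun p q => pers g₁ m₁ hg (hk₁ ⟨a, Sum.inr (p, q)⟩)),
      Matrix.map_one _ (map_zero _) (map_one _)]
  have hWW : ∀ a b, W a ⊓ W b ≤ D.map g ⁻¹ᵁ (D.map f ⁻¹ᵁ V a ⊓ D.map f ⁻¹ᵁ V b) := fun a b => by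
    rw [Scheme.Hom.preimage_inf]; exact inf_le_inf (hWle a) (hWle b)
  have hG3 : ∀ a b,
      transition (eFk a) (eFk b) (Opens.infLELeft (W a) (W b)) (Opens.infLERight (W a) (W b)) *
          (G b).map ((D.obj k).presheaf.map (Opens.infLERight (W a) (W b)).op).hom =
        (G a).map ((D.obj k).presheaf.map (Opens.infLELeft (W a) (W b)).op).hom *
          transition (eEk a) (eEk b) (Opens.infLELeft (W a) (W b)) (Opens.infLERight (W a) (W b)) := by
    intro a b
    have key : (sL a b).map ((D.map g).appLE _ (W a ⊓ W b) (hWW a b)).hom =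
        (sR a b).map ((D.map g).appLE _ (W a ⊓ W b) (hWW a b)).hom :=
      map_appLE_eq_of_forall_app_eq (D.map g) (hWW a b)
        (fun p q => pers g₂ m₂ hg' (hk₂ ⟨(a, b), (p, q)⟩))
    simp only [sL, sR, Matrix.map_mul] at key
    have e1 : transition (eFk a) (eFk b) (Opens.infLELeft (W a) (W b)) (Opens.infLERight (W a) (W b)) =
        ((TF a b).map ((D.map f).appLE (V a ⊓ V b) _ (hO a b)).hom).map
          ((D.map g).appLE _ (W a ⊓ W b) (hWW a b)).hom := by
      simp only [eFk, TF]
      rw [map_appLE_map_appLE', ← appLE_congr_hom' (D.map_comp g f),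
        transition_pullbackFrame (D.map (g ≫ f)) (eF a) (eF b)
          (le_of_eq (Scheme.Hom.preimage_inf (D.map (g ≫ f))).symm)]
    have e2 : transition (eEk a) (eEk b) (Opens.infLELeft (W a) (W b)) (Opens.infLERight (W a) (W b)) =
        ((TE a b).map ((D.map f).appLE (V a ⊓ V b) _ (hO a b)).hom).map
          ((D.map g).appLE _ (W a ⊓ W b) (hWW a b)).hom := by
      simp only [eEk, TE]
      rw [map_appLE_map_appLE', ← appLE_congr_hom' (D.map_comp g f),
        transition_pullbackFrame (D.map (g ≫ f)) (eE a) (eE b)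
          (le_of_eq (Scheme.Hom.preimage_inf (D.map (g ≫ f))).symm)]
    have e3 : (G b).map ((D.obj k).presheaf.map (Opens.infLERight (W a) (W b)).op).hom =
        ((Mj b).map ((D.obj j).presheaf.map (homOfLE (inf_le_right :
          D.map f ⁻¹ᵁ V a ⊓ D.map f ⁻¹ᵁ V b ≤ D.map f ⁻¹ᵁ V b)).op).hom).map
          ((D.map g).appLE _ (W a ⊓ W b) (hWW a b)).hom := by
      simp only [G]
      rw [map_secRes_map_appLE',
        show (Opens.infLERight (W a) (W b)) = homOfLE inf_le_right from rfl,
        map_appLE_map_secRes' (D.map g) inf_le_right (hWle b)]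
    have e4 : (G a).map ((D.obj k).presheaf.map (Opens.infLELeft (W a) (W b)).op).hom =
        ((Mj a).map ((D.obj j).presheaf.map (homOfLE (inf_le_left :
          D.map f ⁻¹ᵁ V a ⊓ D.map f ⁻¹ᵁ V b ≤ D.map f ⁻¹ᵁ V a)).op).hom).map
          ((D.map g).appLE _ (W a ⊓ W b) (hWW a b)).hom := by
      simp only [G]
      rw [map_secRes_map_appLE',
        show (Opens.infLELeft (W a) (W b)) = homOfLE inf_le_left from rfl,
        map_appLE_map_secRes' (D.map g) inf_le_left (hWle a)]
    rw [e1, e2, e3, e4]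
    exact key
  exact nonempty_iso_of_framesMatrix W eEk eFk G hG3 G' hG1 hG2 hWtop

end Descent

end FiniteLocallyFreeIsoDescent

end Literature.AlgebraicGeometry.Limits
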